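import Literature.Analysis.OperatorTheory.YangMillsMatrixModelRotationAverage
import Literature.Analysis.OperatorTheory.YangMillsMatrixModelAgmonPointwise
import Literature.Analysis.OperatorTheory.YangMillsMatrixModelEigenfunctions
import HarnessLib

/-!
# AL1 from a weak invariant eigen-sequence: `LuscherHamiltonianEigenfunctions k` for every `k`, given the variational
# eigenvectors of Lüscher's matrix-model form (assembly N6 of the AL1 programme)

Topic `Literature/Analysis/OperatorTheory`.  The named fact `LuscherHamiltonianEigenfunctions k` (AL1,
`YangMillsMatrixModelEigenfunctions.lean`: smooth, colour-invariant, `L²`-orthonormal, exponentially decaying classical eigenfunctions of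
`𝔥 = −½Δ + V` realising the invariant min–max levels `physLevel 1, …, physLevel (k+1)`) is DERIVED here from the output format of the
variational principle on the invariant form core (Reed–Simon IV Thm XIII.64 on a core, the tree's
`Literature.Analysis.UnboundedOperators.exists_core_form_eigenseq`): an `L²`-orthonormal sequence `u : ℕ → L²(ℝ⁹)` of limits of invariant
`C²_c` functions with the weak eigen-equation `∫ u_k · 𝔥g = physLevel (k+1) ∫ u_k · g` for invariant test functions `g`.

The two halves assembled: `smooth_gaugeInv_eigenseq_of_weak` (seat ym-beyond-lit: `SO(3)`-averaging + hypoellipticity ⇒ smooth invariant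
classical `L²`-orthonormal eigenfunctions, `YangMillsMatrixModelRotationAverage.lean` / `…WeakSolutions.lean`) and `expDecay₂_of_eigenfunction`
(this seat: Agmon–Caccioppoli weighted `L²` decay of all derivatives + local Sobolev bound ⇒ `ExpDecay₂`, `YangMillsMatrixModelAgmonPointwise.lean`).

* ★ `luscherHamiltonianEigenfunctions_of_weak_eigenseq` — the named fact for every `k`, from such a sequence `u`.

Theorems only; no definitions, no named facts.  What remains for the unconditional `LuscherHamiltonianEigenfunctions_holds` is the
instantiation of `exists_core_form_eigenseq` for the invariant core (closability/Rellich/level identification), which produces `u`.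

## References
* [ReedSimonIV1978] M. Reed, B. Simon, *Methods of Modern Mathematical Physics IV*, Thm. XIII.64, Thms. XIII.1–2.
* [Agmon1982] S. Agmon, *Lectures on Exponential Decay…*, Cor. 4.5, Thm. 5.1.
-/

noncomputable section

open MeasureTheory Filter Topology Function
open scoped BigOperators ContDiff

namespace Literature.Analysis.OperatorTheory.YMMatrixModel

/-- ★ **AL1 from a weak invariant eigen-sequence.**  Let `u : ℕ → L²(ℝ⁹)` be `L²`-orthonormal, each `u k` an `L²`-limit of invariant `C²_c`
functions, with `∫ u_k · 𝔥g = physLevel (k+1) · ∫ u_k · g` for every invariant test function `g`.  Then for every `k` the named fact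
`LuscherHamiltonianEigenfunctions k` holds: the smooth invariant classical representatives of `u_0, …, u_k` are `L²`-orthonormal eigenfunctions at
the levels `physLevel 1, …, physLevel (k+1)` and decay exponentially with their first and second derivatives.
[cite: ReedSimonIV1978, Thm. XIII.64] [cite: Agmon1982, Cor. 4.5, Thm. 5.1] -/
theorem luscherHamiltonianEigenfunctions_of_weak_eigenseq (u : ℕ → Lp ℝ 2 (volume : Measure ZM))
    (hon : Orthonormal ℝ u)
    (hcl : ∀ k, u k ∈ closure {v : Lp ℝ 2 (volume : Measure ZM) |
      ∃ ψ : ZM → ℝ, IsTestFn ψ ∧ IsGaugeInv ψ ∧ (v : ZM → ℝ) =ᵐ[volume] ψ})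
    (hweak : ∀ (k : ℕ) (g : ZM → ℝ), IsTestFn g → IsGaugeInv g →
      ∫ x, u k x * hApply g x = physLevel (k + 1) * ∫ x, u k x * g x) (k : ℕ) :
    LuscherHamiltonianEigenfunctions k := by
  obtain ⟨f, hf, hfi, horth, hfE, hf2, -⟩ := smooth_gaugeInv_eigenseq_of_weak u hon hcl hweak
  refine ⟨fun j => f j, fun j n => hf j n, fun j => hfi j, fun i j => ?_, fun j x => hfE j x, fun j => ?_⟩
  · rw [horth i j]
    by_cases hij : i = j
    · subst hij; simp
    · have hne : (i : ℕ) ≠ j := fun h => hij (Fin.ext h)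
      simp [hij, hne]
  · have hsmooth : ContDiff ℝ ∞ (f j) := hf j ⊤
    have hsq : Integrable (fun x => f j x ^ 2) := (hf2 j).integrable_sq
    exact expDecay₂_of_eigenfunction hsmooth hsq (hfE j)

end Literature.Analysis.OperatorTheory.YMMatrixModel

end
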